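import Literature.Analysis.FluidPDE.NSRegFourierPicard
import Literature.Analysis.FluidPDE.NSRegFourierTrilinear
import Mathlib.Analysis.InnerProductSpace.Calculus
import HarnessLib

/-!
# Fourier-side mild solutions of the Leray-regularised Navier–Stokes system: the notion, its
# differential form and the energy identity

Fourth file of the Fourier-side construction of the global regular solution of the
Leray-regularised Navier–Stokes system (discharge of
`Literature.Analysis.FluidPDE.leray_regularised_wellposed`). A **regularised mild solution on
`[t₀, t₁]`** (`IsRegMild c m K t₀ t₁ V`) is a coefficient field `V : ℝ → E → (ι → ℂ)`
(`E = EuclideanSpace ℝ ι`), jointly measurable, continuous in time at every frequency, dominated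
pointwise by a square-integrable function of the frequency, with `wfun K V(t)` bounded in `L²`
uniformly in time, transversal and conjugation symmetric, which satisfies the two-time Duhamel
formula of the regularised system

  `V(t, ξ) = e^{-c‖ξ‖²(t-s)} V(s, ξ) − ∫ₛᵗ e^{-c‖ξ‖²(t-r)} N(m • V(r), V(r))(ξ) dr`,
  `t₀ ≤ s ≤ t ≤ t₁`

(Leray 1934, §26 with §19; Ożański–Pooley 2018, (6.77); in the mild/Fourier setting
Lemarié-Rieusset 2016, §7.3/§8.5). This is the notion that restricts, translates and glues (next
file) and of which the Picard limit of `NSRegFourierPicard` is the basic example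
(`RPicardHyp.isRegMild_limit`). Here:

* `IsRegMild` and its API: uniform `L²` bounds (`exists_bound`), `SliceBound`, square-integrable
  slices, **`L²` continuity in time** (`tendsto_eLpNorm_sub`, dominated convergence), continuity in
  time of the regularised nonlinearity at each frequency (`continuous_nonlin_time`);
* `IsRegMild.hasDerivWithinAt` — **mild ⇒ differential**: at every frequency,
  `∂ₜ V(t,ξ) = -c‖ξ‖² V(t,ξ) − N(m•V(t), V(t))(ξ)` within `[t₀, t₁]`;
* `IsRegMild.energy_eq` — **the energy identity**
  `∑ₗ ∫ ‖V(t,ξ)ₗ‖² dξ + 2c ∫ₛᵗ ∑ₗ ∫ ‖ξ‖² ‖V(r,ξ)ₗ‖² dξ dr = ∑ₗ ∫ ‖V(s,ξ)ₗ‖² dξ` for `1 ≤ K`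
  (pointwise `∂ₜ‖Vₗ‖² = -2c‖ξ‖²‖Vₗ‖² − 2 Re (conj Vₗ Nₗ)`, Fubini, and the cancellation
  `∫ ∑ₗ conj Vₗ Nₗ = 0` of `NSRegFourierTrilinear`) — the Fourier side (Plancherel) of Leray's
  "relation de dissipation de l'énergie" for the regularised system (Leray 1934, (3.4) with §26;
  Ożański–Pooley 2018, (6.80)); in particular the Euclidean energy `∑ₗ ‖V(t)ₗ‖²_{L²}` is
  non-increasing (`energy_le`), the a priori bound that makes the local existence time uniform.

## References

* J. Leray, Acta Math. 63 (1934), §17 (3.4), §19, Ch. V §26. [Leray1934]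
* W. S. Ożański, B. C. Pooley, LMS Lecture Note Ser. 452 (2018), Thm. 6.33, (6.77)–(6.80). [OzanskiPooley2018]
* P. G. Lemarié-Rieusset, *The Navier–Stokes problem in the 21st century* (2016), §7.3, §8.5.
-/

noncomputable section

open MeasureTheory Real Set Filter Topology Function Complex intervalIntegral
open scoped ENNReal NNReal ComplexConjugate

namespace Literature.Analysis.FluidPDE.FourierNS

variable {ι : Type*} [Fintype ι] [DecidableEq ι]

/-! ### Regularised mild solutions -/

/-- **Regularised mild solution on `[t₀, t₁]`** of the Fourier-transformed Leray-regularised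
Navier–Stokes system with heat rate `c`, mollifier multiplier `m` and weight `K`: jointly
measurable, continuous in `t` at each frequency, dominated by a square-integrable function of
the frequency, `wfun K V(t)` bounded in `L²` uniformly in `t`, the two-time Duhamel formula on
`[t₀, t₁]`, transversality and conjugation symmetry (Leray 1934, §26; Ożański–Pooley 2018, (6.77);
Lemarié-Rieusset 2016, §7.3). [folklore] -/
structure IsRegMild (c : ℝ) (m : (EuclideanSpace ℝ ι) → ℝ) (K : ℕ) (t₀ t₁ : ℝ)
    (V : ℝ → (EuclideanSpace ℝ ι) → ι → ℂ) : Prop where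
  /-- positivity of the heat rate -/
  hc : 0 < c
  /-- the multiplier is a mollifier symbol -/
  hm : IsMollifierSymbol m
  /-- the interval is nonempty -/
  le : t₀ ≤ t₁
  /-- joint measurability -/
  meas : Measurable (uncurry V)
  /-- continuity in time at each frequency -/
  cont : ∀ ξ, Continuous fun t => V t ξ
  /-- domination by a square-integrable function of the frequency, uniformly in time -/
  dom : ∃ G : (EuclideanSpace ℝ ι) → ℝ≥0∞, Measurable G ∧ ∫⁻ ξ, G ξ ^ 2 < ∞ ∧ ∀ t ξ, ‖V t ξ‖ₑ ≤ G ξ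
  /-- the weighted `L²` bound, uniform in time -/
  boundK : ∃ B : ℝ≥0∞, B ≠ ∞ ∧ ∀ t, eLpNorm (wfun K (V t)) 2 volume ≤ B
  /-- the two-time Duhamel formula on `[t₀, t₁]` -/
  duhamel : ∀ ⦃s t : ℝ⦄, t₀ ≤ s → s ≤ t → t ≤ t₁ → ∀ ξ,
    V t ξ = heat c ξ (t - s) • V s ξ - ∫ r in s..t, heat c ξ (t - r) • nonlin (vmul m (V r)) (V r) ξ
  /-- transversality (incompressibility on the Fourier side) -/
  divFree : ∀ t ξ, ∑ l, (ξ l : ℂ) * V t ξ l = 0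
  /-- conjugation symmetry (reality of `𝓕 V(t)`) -/
  conjSymm : ∀ t ξ l, V t (-ξ) l = conj (V t ξ l)

namespace IsRegMild

variable {c t₀ t₁ : ℝ} {m : (EuclideanSpace ℝ ι) → ℝ} {K : ℕ} {V : ℝ → (EuclideanSpace ℝ ι) → ι → ℂ}

/-- Slices are measurable. [folklore] -/
theorem measurable_slice' (h : IsRegMild c m K t₀ t₁ V) (t : ℝ) : Measurable (V t) :=
  measurable_slice h.meas t

/-- **Uniform `L²` bound of the slices** (from the domination): `‖V(t)‖_{L²} ≤ A < ∞`. [folklore] -/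
theorem exists_bound (h : IsRegMild c m K t₀ t₁ V) : ∃ A : ℝ≥0∞, A ≠ ∞ ∧ ∀ t, eLpNorm (V t) 2 volume ≤ A := by
  obtain ⟨G, -, hG2, hle⟩ := h.dom
  refine ⟨(∫⁻ ξ, G ξ ^ 2) ^ (1 / 2 : ℝ), ENNReal.rpow_ne_top_of_nonneg (by norm_num) hG2.ne, fun t => ?_⟩
  rw [eLpNorm_eq_lintegral_rpow_enorm_toReal two_ne_zero ENNReal.ofNat_ne_top, ENNReal.toReal_ofNat]
  refine ENNReal.rpow_le_rpow (lintegral_mono fun ξ => ?_) (by norm_num)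
  rw [ENNReal.rpow_two]
  exact pow_le_pow_left₀ zero_le (hle t ξ) 2

/-- A chosen uniform `L²` bound. [folklore] -/
def A (h : IsRegMild c m K t₀ t₁ V) : ℝ≥0∞ := h.exists_bound.choose

/-- `A < ∞`. [folklore] -/
theorem A_ne_top (h : IsRegMild c m K t₀ t₁ V) : h.A ≠ ∞ := h.exists_bound.choose_spec.1

/-- `‖V(t)‖_{L²} ≤ A`. [folklore] -/
theorem eLpNorm_le_A (h : IsRegMild c m K t₀ t₁ V) (t : ℝ) : eLpNorm (V t) 2 volume ≤ h.A :=
  h.exists_bound.choose_spec.2 t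

/-- A chosen uniform weighted `L²` bound. [folklore] -/
def B (h : IsRegMild c m K t₀ t₁ V) : ℝ≥0∞ := h.boundK.choose

/-- `B < ∞`. [folklore] -/
theorem B_ne_top (h : IsRegMild c m K t₀ t₁ V) : h.B ≠ ∞ := h.boundK.choose_spec.1

/-- `‖wfun K V(t)‖_{L²} ≤ B`. [folklore] -/
theorem eLpNorm_wfun_le_B (h : IsRegMild c m K t₀ t₁ V) (t : ℝ) : eLpNorm (wfun K (V t)) 2 volume ≤ h.B :=
  h.boundK.choose_spec.2 t

/-- **The slice bounds of the pair `(V, V)`.** [folklore] -/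
theorem sliceBound (h : IsRegMild c m K t₀ t₁ V) : SliceBound K h.A h.B V V :=
  ⟨h.meas, h.meas, h.eLpNorm_le_A, h.eLpNorm_wfun_le_B, h.A_ne_top, h.B_ne_top⟩

/-- Slices are square integrable. [folklore] -/
theorem memLp (h : IsRegMild c m K t₀ t₁ V) (t : ℝ) : MemLp (V t) 2 volume :=
  ⟨(h.measurable_slice' t).aestronglyMeasurable, (h.eLpNorm_le_A t).trans_lt h.A_ne_top.lt_top⟩

/-- Weighted slices are square integrable. [folklore] -/
theorem eLpNorm_wfun_lt_top (h : IsRegMild c m K t₀ t₁ V) (t : ℝ) : eLpNorm (wfun K (V t)) 2 volume < ∞ :=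
  (h.eLpNorm_wfun_le_B t).trans_lt h.B_ne_top.lt_top

/-! #### `L²` continuity in time -/

/-- **`L²` continuity in time**: `‖V(s) − V(t)‖_{L²} → 0` as `s → t` (pointwise continuity in time
and the square-integrable domination; dominated convergence). [folklore] -/
theorem tendsto_eLpNorm_sub (h : IsRegMild c m K t₀ t₁ V) (t : ℝ) :
    Tendsto (fun s => eLpNorm (V s - V t) 2 volume) (𝓝 t) (𝓝 0) := by
  obtain ⟨G, hGm, hG2, hle⟩ := h.dom
  -- domination of the squared difference by `4 G²`
  have hdom : ∀ s ξ, ‖V s ξ - V t ξ‖ₑ ^ 2 ≤ 4 * G ξ ^ 2 := by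
    intro s ξ
    calc ‖V s ξ - V t ξ‖ₑ ^ 2 ≤ (‖V s ξ‖ₑ + ‖V t ξ‖ₑ) ^ 2 := by gcongr; exact enorm_sub_le
      _ ≤ (G ξ + G ξ) ^ 2 := by gcongr <;> exact hle _ ξ
      _ = 4 * G ξ ^ 2 := by ring
  have hBint : ∫⁻ ξ, 4 * G ξ ^ 2 ≠ ∞ := by
    rw [lintegral_const_mul _ (hGm.pow_const 2)]
    exact ENNReal.mul_ne_top ENNReal.ofNat_ne_top hG2.ne
  have hmeas : ∀ s, Measurable fun ξ => ‖V s ξ - V t ξ‖ₑ ^ 2 := fun s =>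
    ((h.measurable_slice' s).sub (h.measurable_slice' t)).enorm.pow_const 2
  have hpt : ∀ ξ, Tendsto (fun s => ‖V s ξ - V t ξ‖ₑ ^ 2) (𝓝 t) (𝓝 0) := by
    intro ξ
    have h1 : Tendsto (fun s => V s ξ - V t ξ) (𝓝 t) (𝓝 (V t ξ - V t ξ)) := ((h.cont ξ).tendsto t).sub_const _
    rw [sub_self] at h1
    have h2 : Tendsto (fun s => ‖V s ξ - V t ξ‖ₑ ^ 2) (𝓝 t) (𝓝 (‖(0 : ι → ℂ)‖ₑ ^ 2)) :=
      ((ENNReal.continuous_pow 2).tendsto _).comp ((continuous_enorm.tendsto _).comp h1)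
    simpa using h2
  have hDC := tendsto_lintegral_filter_of_dominated_convergence (fun ξ => 4 * G ξ ^ 2) (Eventually.of_forall hmeas)
    (Eventually.of_forall fun s => Eventually.of_forall fun ξ => hdom s ξ) hBint (Eventually.of_forall hpt)
  simp only [lintegral_zero] at hDC
  have heq : ∀ s, eLpNorm (V s - V t) 2 volume = (∫⁻ ξ, ‖V s ξ - V t ξ‖ₑ ^ 2) ^ (1 / 2 : ℝ) := by
    intro s
    rw [← sq_rpow_half (eLpNorm (V s - V t) 2 volume), ← lintegral_enorm_sq_eq_eLpNorm_sq]
    rfl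
  simp_rw [heq]
  have h0 : (0 : ℝ≥0∞) = 0 ^ (1 / 2 : ℝ) := by rw [ENNReal.zero_rpow_of_pos (by norm_num)]
  rw [h0]
  exact (ENNReal.continuous_rpow_const.tendsto 0).comp hDC

/-! #### Continuity in time of the regularised nonlinearity -/

/-- **Pointwise continuity of the nonlinearity under `L²` perturbations**: for square-integrable
`V₁, V₂, W₁, W₂` and `|m| ≤ 1`,
`‖N(m•V₁, W₁)(ξ) − N(m•V₂, W₂)(ξ)‖ ≤ 4π‖ξ‖ card² (‖V₁ − V₂‖_{L²} ‖W₁‖_{L²} + ‖V₂‖_{L²} ‖W₁ − W₂‖_{L²})`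
(bilinearity and the pointwise Cauchy–Schwarz bound of `NSRegFourierBilinear`). [folklore] -/
theorem enorm_nonlin_sub_le {m : (EuclideanSpace ℝ ι) → ℝ} (hm : Measurable m) (hm1 : ∀ ξ, |m ξ| ≤ 1)
    {V₁ V₂ W₁ W₂ : (EuclideanSpace ℝ ι) → ι → ℂ} (hV₁ : Measurable V₁) (hV₂ : Measurable V₂)
    (hW₁ : Measurable W₁) (hW₂ : Measurable W₂) (hV₁2 : MemLp V₁ 2 volume) (hV₂2 : MemLp V₂ 2 volume)
    (hW₁2 : MemLp W₁ 2 volume) (hW₂2 : MemLp W₂ 2 volume) (ξ : EuclideanSpace ℝ ι) :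
    ‖nonlin (vmul m V₁) W₁ ξ - nonlin (vmul m V₂) W₂ ξ‖ₑ ≤
      ENNReal.ofReal (4 * π * ‖ξ‖) * ((Fintype.card ι : ℝ≥0∞) ^ 2 *
        (eLpNorm (V₁ - V₂) 2 volume * eLpNorm W₁ 2 volume + eLpNorm V₂ 2 volume * eLpNorm (W₁ - W₂) 2 volume)) := by
  have hsplit : nonlin (vmul m V₁) W₁ ξ - nonlin (vmul m V₂) W₂ ξ =
      nonlin (vmul m (V₁ - V₂)) W₁ ξ + nonlin (vmul m V₂) (W₁ - W₂) ξ := by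
    rw [nonlin_vmul_sub_left hm hm1 hV₁2 hV₂2 hW₁2, nonlin_vmul_sub_right hm hm1 hV₂2 hW₁2 hW₂2]; abel
  rw [hsplit]
  have hone : ∀ ξ : EuclideanSpace ℝ ι, (1 + ‖ξ‖) ^ 0 * |m ξ| ≤ 1 := fun ξ => by simpa using hm1 ξ
  have hb : ∀ {V W : (EuclideanSpace ℝ ι) → ι → ℂ}, Measurable V → Measurable W →
      ‖nonlin (vmul m V) W ξ‖ₑ ≤ ENNReal.ofReal (4 * π * ‖ξ‖) * ((Fintype.card ι : ℝ≥0∞) ^ 2 *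
        (eLpNorm V 2 volume * eLpNorm W 2 volume)) := by
    intro V W hV hW
    have h1 := weight_mul_convSum_le hm hV hW (K := 0) hone ξ
    simp only [pow_zero, one_mul, ENNReal.ofReal_one] at h1
    rw [← ofReal_norm]
    calc ENNReal.ofReal ‖nonlin (vmul m V) W ξ‖ ≤ ENNReal.ofReal (4 * π * ‖ξ‖ * convSum (vmul m V) W ξ) :=
          ENNReal.ofReal_le_ofReal (norm_nonlin_le_convSum' _ _ ξ)
      _ = ENNReal.ofReal (4 * π * ‖ξ‖) * ENNReal.ofReal (convSum (vmul m V) W ξ) := ENNReal.ofReal_mul (by positivity)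
      _ ≤ _ := by gcongr; simpa using h1
  calc ‖nonlin (vmul m (V₁ - V₂)) W₁ ξ + nonlin (vmul m V₂) (W₁ - W₂) ξ‖ₑ
      ≤ ‖nonlin (vmul m (V₁ - V₂)) W₁ ξ‖ₑ + ‖nonlin (vmul m V₂) (W₁ - W₂) ξ‖ₑ := enorm_add_le _ _
    _ ≤ _ := add_le_add (hb (hV₁.sub hV₂) hW₁) (hb hV₂ (hW₁.sub hW₂))
    _ = _ := by ring

/-- **The regularised nonlinearity of a mild solution is continuous in time at each frequency**
(`L²` continuity in time and the pointwise bound above). [folklore] -/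
theorem continuous_nonlin_time (h : IsRegMild c m K t₀ t₁ V) (ξ : EuclideanSpace ℝ ι) :
    Continuous fun t => nonlin (vmul m (V t)) (V t) ξ := by
  have hm := h.hm.measurable
  have hm1 := h.hm.abs_le_one
  rw [continuous_iff_continuousAt]
  intro t
  rw [ContinuousAt, tendsto_iff_edist_tendsto_0]
  have hbound : ∀ s, edist (nonlin (vmul m (V s)) (V s) ξ) (nonlin (vmul m (V t)) (V t) ξ) ≤
      ENNReal.ofReal (4 * π * ‖ξ‖) * ((Fintype.card ι : ℝ≥0∞) ^ 2 *
        (eLpNorm (V s - V t) 2 volume * h.A + h.A * eLpNorm (V s - V t) 2 volume)) := by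
    intro s
    rw [edist_eq_enorm_sub]
    refine (enorm_nonlin_sub_le hm hm1 (h.measurable_slice' s) (h.measurable_slice' t) (h.measurable_slice' s)
      (h.measurable_slice' t) (h.memLp s) (h.memLp t) (h.memLp s) (h.memLp t) ξ).trans ?_
    gcongr
    · exact h.eLpNorm_le_A s
    · exact h.eLpNorm_le_A t
  have hlim : Tendsto (fun s => ENNReal.ofReal (4 * π * ‖ξ‖) * ((Fintype.card ι : ℝ≥0∞) ^ 2 *
      (eLpNorm (V s - V t) 2 volume * h.A + h.A * eLpNorm (V s - V t) 2 volume))) (𝓝 t) (𝓝 0) := by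
    have h1 := h.tendsto_eLpNorm_sub t
    have h2 : Tendsto (fun s => eLpNorm (V s - V t) 2 volume * h.A) (𝓝 t) (𝓝 (0 * h.A)) :=
      ENNReal.Tendsto.mul_const h1 (Or.inr h.A_ne_top)
    have h3 : Tendsto (fun s => h.A * eLpNorm (V s - V t) 2 volume) (𝓝 t) (𝓝 (h.A * 0)) :=
      ENNReal.Tendsto.const_mul h1 (Or.inr h.A_ne_top)
    rw [zero_mul] at h2; rw [mul_zero] at h3
    have h4 := h2.add h3
    rw [add_zero] at h4
    have h5 : Tendsto (fun s => (Fintype.card ι : ℝ≥0∞) ^ 2 *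
        (eLpNorm (V s - V t) 2 volume * h.A + h.A * eLpNorm (V s - V t) 2 volume)) (𝓝 t) (𝓝 ((Fintype.card ι : ℝ≥0∞) ^ 2 * 0)) :=
      ENNReal.Tendsto.const_mul h4 (Or.inr (ENNReal.pow_ne_top (ENNReal.natCast_ne_top _)))
    rw [mul_zero] at h5
    have h6 := ENNReal.Tendsto.const_mul h5 (Or.inr (ENNReal.ofReal_ne_top (r := 4 * π * ‖ξ‖)))
    rwa [mul_zero] at h6
  exact tendsto_of_tendsto_of_tendsto_of_le_of_le tendsto_const_nhds hlim (fun s => zero_le) hbound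

/-! #### Mild ⇒ differential -/

/-- **Mild ⇒ differential.** A regularised mild solution satisfies, at every frequency and every
`t ∈ [t₀, t₁]`, `∂ₜ V(t, ξ) = -c‖ξ‖² V(t, ξ) − N(m•V(t), V(t))(ξ)` as a derivative within
`[t₀, t₁]` (differentiate `V(t) = e^{-β(t-t₀)} V(t₀) − e^{-βt} ∫_{t₀}ᵗ e^{βr} N(r) dr`, `β = c‖ξ‖²`,
by the product rule and the fundamental theorem of calculus, the integrand being continuous;
Leray 1934, §19; Lemarié-Rieusset 2016, §8.5). [folklore] -/
theorem hasDerivWithinAt (h : IsRegMild c m K t₀ t₁ V) (ξ : EuclideanSpace ℝ ι) {t : ℝ} (ht : t ∈ Icc t₀ t₁) :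
    HasDerivWithinAt (fun s => V s ξ)
      (-(c * ‖ξ‖ ^ 2) • V t ξ - nonlin (vmul m (V t)) (V t) ξ) (Icc t₀ t₁) t := by
  set β := c * ‖ξ‖ ^ 2 with hβ
  set N : ℝ → ι → ℂ := fun s => nonlin (vmul m (V s)) (V s) ξ with hN
  have hNc : Continuous N := h.continuous_nonlin_time ξ
  -- `G s = ∫_{t₀}ˢ e^{βσ} N(σ) dσ` and its derivative
  set G : ℝ → ι → ℂ := fun s => ∫ σ in t₀..s, Real.exp (β * σ) • N σ with hG
  have hGi : Continuous fun σ => Real.exp (β * σ) • N σ :=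
    (Real.continuous_exp.comp (continuous_const.mul continuous_id)).smul hNc
  have hG' : ∀ s, HasDerivAt G (Real.exp (β * s) • N s) s := fun s =>
    (hGi.integral_hasStrictDerivAt t₀ s).hasDerivAt
  have hheat : ∀ s, heat c ξ s = Real.exp (-β * s) := fun s => by simp [heat, hβ]
  have hE' : ∀ s, HasDerivAt (fun s => Real.exp (-β * s)) (-β * Real.exp (-β * s)) s := fun s => by
    have := ((hasDerivAt_id s).const_mul (-β)).exp
    simpa [mul_comm] using this
  have hE'' : ∀ s, HasDerivAt (fun s => Real.exp (-β * (s - t₀))) (-β * Real.exp (-β * (s - t₀))) s := fun s => by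
    have := (((hasDerivAt_id s).sub_const t₀).const_mul (-β)).exp
    simpa [mul_comm] using this
  -- `F s = e^{-β(s-t₀)} V t₀ − e^{-βs} G s` is the Duhamel formula from `t₀`
  set F : ℝ → ι → ℂ := fun s => Real.exp (-β * (s - t₀)) • V t₀ ξ - Real.exp (-β * s) • G s with hF
  have hF' : ∀ s, HasDerivAt F (-β • F s - N s) s := by
    intro s
    have h1 : HasDerivAt (fun s => Real.exp (-β * (s - t₀)) • V t₀ ξ) ((-β * Real.exp (-β * (s - t₀))) • V t₀ ξ) s :=
      (hE'' s).smul_const _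
    have h2 : HasDerivAt (fun s => Real.exp (-β * s) • G s)
        (Real.exp (-β * s) • (Real.exp (β * s) • N s) + (-β * Real.exp (-β * s)) • G s) s :=
      (hE' s).smul (hG' s)
    have h3 := h1.sub h2
    have hone : Real.exp (-β * s) * Real.exp (β * s) = 1 := by rw [← Real.exp_add]; simp
    have heq : (-β * Real.exp (-β * (s - t₀))) • V t₀ ξ -
        (Real.exp (-β * s) • (Real.exp (β * s) • N s) + (-β * Real.exp (-β * s)) • G s) = -β • F s - N s := by
      simp only [hF, smul_sub, smul_smul, hone, one_smul]
      module
    rw [heq] at h3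
    exact h3
  -- on `[t₀, t₁]`, `V s ξ = F s`
  have hvF : ∀ s ∈ Icc t₀ t₁, V s ξ = F s := by
    intro s hs
    rw [h.duhamel le_rfl hs.1 hs.2 ξ, hheat]
    have hint : (∫ r in t₀..s, heat c ξ (s - r) • nonlin (vmul m (V r)) (V r) ξ) = Real.exp (-β * s) • G s := by
      simp only [hG]
      rw [← intervalIntegral.integral_smul]
      refine intervalIntegral.integral_congr fun σ _ => ?_
      change heat c ξ (s - σ) • N σ = Real.exp (-β * s) • (Real.exp (β * σ) • N σ)
      rw [hheat, smul_smul, ← Real.exp_add]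
      congr 1; ring_nf
    rw [hint]
  have key := (hF' t).hasDerivWithinAt (s := Icc t₀ t₁)
  rw [← hvF t ht] at key
  exact key.congr (fun s hs => hvF s hs) (hvF t ht)

/-- Componentwise form of `IsRegMild.hasDerivWithinAt`. [folklore] -/
theorem hasDerivWithinAt_apply (h : IsRegMild c m K t₀ t₁ V) (ξ : EuclideanSpace ℝ ι) {t : ℝ}
    (ht : t ∈ Icc t₀ t₁) (l : ι) :
    HasDerivWithinAt (fun s => V s ξ l)
      (-((c * ‖ξ‖ ^ 2 : ℝ) : ℂ) * V t ξ l - nonlin (vmul m (V t)) (V t) ξ l) (Icc t₀ t₁) t := by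
  have := hasDerivWithinAt_pi.1 (h.hasDerivWithinAt ξ ht) l
  simpa [Complex.real_smul] using this


/-! #### The energy identity -/

/-- The time derivative of the squared modulus of a component: on `[t₀, t₁]`,
`∂ₜ ‖V(t,ξ)ₗ‖² = 2 Re ((−c‖ξ‖² V(t,ξ)ₗ − N(t,ξ)ₗ) conj (V(t,ξ)ₗ))`. [folklore] -/
theorem hasDerivWithinAt_normSq (h : IsRegMild c m K t₀ t₁ V) (ξ : EuclideanSpace ℝ ι) {t : ℝ}
    (ht : t ∈ Icc t₀ t₁) (l : ι) :
    HasDerivWithinAt (fun s => ‖V s ξ l‖ ^ 2)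
      (2 * ((-((c * ‖ξ‖ ^ 2 : ℝ) : ℂ) * V t ξ l - nonlin (vmul m (V t)) (V t) ξ l) * conj (V t ξ l)).re)
      (Icc t₀ t₁) t := by
  have h1 := (h.hasDerivWithinAt_apply ξ ht l).norm_sq
  simpa only [Complex.inner] using h1

/-- The pointwise energy rate `q(t, ξ) = ∑ₗ 2 Re ((−c‖ξ‖² Vₗ − Nₗ) conj Vₗ)`. [folklore] -/
def erate (c : ℝ) (m : (EuclideanSpace ℝ ι) → ℝ) (V : ℝ → (EuclideanSpace ℝ ι) → ι → ℂ) (t : ℝ)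
    (ξ : EuclideanSpace ℝ ι) : ℝ :=
  ∑ l, 2 * ((-((c * ‖ξ‖ ^ 2 : ℝ) : ℂ) * V t ξ l - nonlin (vmul m (V t)) (V t) ξ l) * conj (V t ξ l)).re

/-- The energy rate splits into the dissipation and the (cancelling) convective part:
`q = −2c‖ξ‖² ∑ₗ ‖Vₗ‖² − 2 Re ∑ₗ conj(Vₗ) Nₗ`. [folklore] -/
theorem erate_eq (t : ℝ) (ξ : EuclideanSpace ℝ ι) :
    erate c m V t ξ = -(2 * c) * (‖ξ‖ ^ 2 * ∑ l, ‖V t ξ l‖ ^ 2) -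
      2 * (∑ l, conj (V t ξ l) * nonlin (vmul m (V t)) (V t) ξ l).re := by
  unfold erate
  rw [Complex.re_sum, Finset.mul_sum, Finset.mul_sum, Finset.mul_sum, ← Finset.sum_sub_distrib]
  refine Finset.sum_congr rfl fun l _ => ?_
  have hsq : (V t ξ l * conj (V t ξ l)).re = ‖V t ξ l‖ ^ 2 := by
    rw [Complex.mul_conj, Complex.ofReal_re, Complex.normSq_eq_norm_sq]
  rw [sub_mul, Complex.sub_re, mul_sub]
  congr 1
  · rw [mul_assoc, show -((c * ‖ξ‖ ^ 2 : ℝ) : ℂ) * (V t ξ l * conj (V t ξ l)) =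
      ((-(c * ‖ξ‖ ^ 2) : ℝ) : ℂ) * (V t ξ l * conj (V t ξ l)) by push_cast; ring,
      Complex.re_ofReal_mul, hsq]
    ring
  · rw [mul_comm (conj (V t ξ l))]

/-- The energy rate is continuous in time at each frequency. [folklore] -/
theorem continuous_erate (h : IsRegMild c m K t₀ t₁ V) (ξ : EuclideanSpace ℝ ι) : Continuous fun t => erate c m V t ξ := by
  unfold erate
  refine continuous_finsetSum _ fun l _ => continuous_const.mul (Complex.continuous_re.comp ?_)
  have hV : Continuous fun t => V t ξ l := (continuous_apply l).comp (h.cont ξ)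
  have hN : Continuous fun t => nonlin (vmul m (V t)) (V t) ξ l := (continuous_apply l).comp (h.continuous_nonlin_time ξ)
  exact ((continuous_const.mul hV).sub hN).mul (Complex.continuous_conj.comp hV)

/-- **The pointwise energy balance**: for `t₀ ≤ s ≤ t ≤ t₁` and every `ξ`,
`∑ₗ ‖V(t,ξ)ₗ‖² − ∑ₗ ‖V(s,ξ)ₗ‖² = ∫ₛᵗ q(r, ξ) dr` (fundamental theorem of calculus at each frequency). [folklore] -/
theorem sum_normSq_sub_eq_integral_erate (h : IsRegMild c m K t₀ t₁ V) (ξ : EuclideanSpace ℝ ι) {s t : ℝ}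
    (hs : t₀ ≤ s) (hst : s ≤ t) (ht : t ≤ t₁) :
    ∑ l, ‖V t ξ l‖ ^ 2 - ∑ l, ‖V s ξ l‖ ^ 2 = ∫ r in s..t, erate c m V r ξ := by
  have hIcc : Icc s t ⊆ Icc t₀ t₁ := Icc_subset_Icc hs ht
  -- FTC for `E(r) = ∑ₗ ‖V r ξ l‖²`
  have hderiv : ∀ r ∈ Icc t₀ t₁, HasDerivWithinAt (fun r => ∑ l, ‖V r ξ l‖ ^ 2) (erate c m V r ξ) (Icc t₀ t₁) r := by
    intro r hr
    have := HasDerivWithinAt.fun_sum (u := Finset.univ) fun l _ => h.hasDerivWithinAt_normSq ξ hr l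
    simpa [erate] using this
  have hcont : ContinuousOn (fun r => ∑ l, ‖V r ξ l‖ ^ 2) (Icc s t) :=
    (continuous_finsetSum _ fun l _ => (((continuous_apply l).comp (h.cont ξ)).norm).pow 2).continuousOn
  have hright : ∀ r ∈ Ioo s t, HasDerivWithinAt (fun r => ∑ l, ‖V r ξ l‖ ^ 2) (erate c m V r ξ) (Ioi r) r := by
    intro r hr
    have hr' : r ∈ Icc t₀ t₁ := hIcc (Ioo_subset_Icc_self hr)
    have hnhds : Icc t₀ t₁ ∈ 𝓝 r := Icc_mem_nhds (lt_of_le_of_lt hs hr.1) (lt_of_lt_of_le hr.2 ht)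
    exact ((hderiv r hr').hasDerivAt hnhds).hasDerivWithinAt
  rw [intervalIntegral.integral_eq_sub_of_hasDeriv_right_of_le hst hcont hright
    ((h.continuous_erate ξ).intervalIntegrable s t)]


/-! #### Integrability for the energy identity -/

/-- `‖·‖²` of an `L²` function is integrable (natural-number square). [folklore] -/
theorem integrable_normSq_of_memLp {α : Type*} [MeasurableSpace α] {μ : Measure α} {F : Type*}
    [NormedAddCommGroup F] {f : α → F} (hf : MemLp f 2 μ) : Integrable (fun x => ‖f x‖ ^ 2) μ := by
  have h2 : MemLp f ((2 : ℕ) : ℝ≥0∞) μ := by simpa using hf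
  exact h2.integrable_norm_pow two_ne_zero

/-- `∑ₗ ‖V(r,ξ)ₗ‖²` is integrable in `ξ`. [folklore] -/
theorem integrable_sum_normSq (h : IsRegMild c m K t₀ t₁ V) (r : ℝ) :
    Integrable (fun ξ => ∑ l, ‖V r ξ l‖ ^ 2) volume :=
  integrable_finsetSum _ fun l _ => integrable_normSq_of_memLp ((h.memLp r).eval l)

/-- `‖ξ‖² ∑ₗ ‖V(r,ξ)ₗ‖²` is integrable in `ξ` when `1 ≤ K` (`‖ξ‖ Vₗ ∈ L²`). [folklore] -/
theorem integrable_normSq_mul_sum_normSq (h : IsRegMild c m K t₀ t₁ V) (hK : 1 ≤ K) (r : ℝ) :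
    Integrable (fun ξ : EuclideanSpace ℝ ι => ‖ξ‖ ^ 2 * ∑ l, ‖V r ξ l‖ ^ 2) volume := by
  have hw : MemLp (wfun 1 (V r)) 2 volume :=
    ⟨aestronglyMeasurable_wfun 1 (h.measurable_slice' r).aestronglyMeasurable,
      (eLpNorm_wfun_mono hK (V r) 2).trans_lt (h.eLpNorm_wfun_lt_top r)⟩
  have hsum : Integrable (fun ξ => ∑ l, ‖wfun 1 (V r) ξ l‖ ^ 2) volume :=
    integrable_finsetSum _ fun l _ => integrable_normSq_of_memLp (hw.eval l)
  refine hsum.mono' ?_ (Eventually.of_forall fun ξ => ?_)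
  · exact ((continuous_norm.measurable.pow_const 2).mul (Finset.measurable_sum _ fun l _ =>
      ((measurable_pi_iff.1 (h.measurable_slice' r) l).norm.pow_const 2))).aestronglyMeasurable
  · rw [Real.norm_of_nonneg (by positivity), Finset.mul_sum]
    refine Finset.sum_le_sum fun l _ => ?_
    simp only [wfun_apply, Pi.smul_apply, norm_smul, pow_one, Real.norm_of_nonneg (by positivity : (0:ℝ) ≤ 1 + ‖ξ‖)]
    rw [mul_pow]
    gcongr
    linarith [norm_nonneg ξ]

/-- **The regularised nonlinearity of a mild solution is in `L²(dξ)`**, uniformly in time: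
`‖N(r)‖_{L²} ≤ 4π κ₁ A B` for `1 ≤ K` (`‖N(ξ)‖ ≤ 4π‖ξ‖ S(ξ) ≤ 4π ‖wfun 1 S ξ‖` and the weighted
`L²` bound of the convolution sum). [folklore] -/
theorem eLpNorm_nonlin_le (h : IsRegMild c m K t₀ t₁ V) (hK : 1 ≤ K) (r : ℝ) :
    eLpNorm (fun ξ => nonlin (vmul m (V r)) (V r) ξ) 2 volume ≤
      ENNReal.ofReal (4 * π) * (kap m 1 * h.A * h.B) := by
  have hm := h.hm.measurable
  have hS := eLpNorm_wfun_convSum_le hm (h.measurable_slice' r) (h.measurable_slice' r) 1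
  calc eLpNorm (fun ξ => nonlin (vmul m (V r)) (V r) ξ) 2 volume
      ≤ eLpNorm (fun ξ => (4 * π) • wfun 1 (convSum (vmul m (V r)) (V r)) ξ) 2 volume := by
        refine eLpNorm_mono fun ξ => ?_
        rw [norm_smul, norm_wfun, pow_one, Real.norm_of_nonneg (by positivity),
          Real.norm_of_nonneg (convSum_nonneg _ _ ξ)]
        calc ‖nonlin (vmul m (V r)) (V r) ξ‖ ≤ 4 * π * ‖ξ‖ * convSum (vmul m (V r)) (V r) ξ := norm_nonlin_le_convSum' _ _ ξ
          _ ≤ 4 * π * ((1 + ‖ξ‖) * convSum (vmul m (V r)) (V r) ξ) := by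
              rw [mul_assoc]; gcongr
              · exact convSum_nonneg _ _ ξ
              · linarith [norm_nonneg ξ]
    _ = ENNReal.ofReal (4 * π) * eLpNorm (wfun 1 (convSum (vmul m (V r)) (V r))) 2 volume := by
        rw [show (fun ξ => (4 * π) • wfun 1 (convSum (vmul m (V r)) (V r)) ξ) =
          (4 * π) • wfun 1 (convSum (vmul m (V r)) (V r)) from rfl, eLpNorm_const_smul,
          Real.enorm_eq_ofReal (by positivity)]
    _ ≤ ENNReal.ofReal (4 * π) * (kap m 1 * h.A * h.B) := by
        refine mul_le_mul_right (hS.trans ?_) _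
        rw [kap]
        calc (Fintype.card ι : ℝ≥0∞) ^ 2 * (eLpNorm (wfun 1 fun ξ => (m ξ : ℂ)) 2 volume * eLpNorm (V r) 2 volume *
              eLpNorm (wfun 1 (V r)) 2 volume)
            ≤ (Fintype.card ι : ℝ≥0∞) ^ 2 * (eLpNorm (wfun 1 fun ξ => (m ξ : ℂ)) 2 volume * h.A * h.B) := by
              gcongr
              · exact h.eLpNorm_le_A r
              · exact (eLpNorm_wfun_mono hK (V r) 2).trans (h.eLpNorm_wfun_le_B r)
          _ = _ := by ring

/-- The regularised nonlinearity of a mild solution is square integrable in `ξ` (`1 ≤ K`). [folklore] -/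
theorem memLp_nonlin (h : IsRegMild c m K t₀ t₁ V) (hK : 1 ≤ K) (r : ℝ) :
    MemLp (fun ξ => nonlin (vmul m (V r)) (V r) ξ) 2 volume := by
  refine ⟨?_, (h.eLpNorm_nonlin_le hK r).trans_lt ?_⟩
  · have hc : Measurable fun ξ : EuclideanSpace ℝ ι => (r, ξ) := measurable_const.prodMk measurable_id
    have := (measurable_nonlin_param h.hm.measurable h.meas h.meas).comp hc
    exact (by simpa only [Function.comp_def, uncurry_apply_pair] using this : Measurable fun ξ =>
      nonlin (vmul m (V r)) (V r) ξ).aestronglyMeasurable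
  · exact ENNReal.mul_lt_top ENNReal.ofReal_lt_top (ENNReal.mul_lt_top (ENNReal.mul_lt_top
      (h.hm.kap_ne_top 1).lt_top h.A_ne_top.lt_top) h.B_ne_top.lt_top)

/-- `∑ₗ conj(V(r,ξ)ₗ) N(r,ξ)ₗ` is integrable in `ξ` (`V(r), N(r) ∈ L²`). [folklore] -/
theorem integrable_sum_conj_mul_nonlin (h : IsRegMild c m K t₀ t₁ V) (hK : 1 ≤ K) (r : ℝ) :
    Integrable (fun ξ => ∑ l, conj (V r ξ l) * nonlin (vmul m (V r)) (V r) ξ l) volume := by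
  refine integrable_finsetSum _ fun l _ => ?_
  have hV : MemLp (fun ξ => conj (V r ξ l)) 2 volume :=
    ⟨(Complex.continuous_conj.measurable.comp (measurable_pi_iff.1 (h.measurable_slice' r) l)).aestronglyMeasurable,
      by rw [eLpNorm_congr_norm_ae (Eventually.of_forall fun ξ => Complex.norm_conj _)]; exact ((h.memLp r).eval l).eLpNorm_lt_top⟩
  exact hV.integrable_mul ((h.memLp_nonlin hK r).eval l)

/-- The energy rate is integrable in `ξ` at every time (`1 ≤ K`). [folklore] -/
theorem integrable_erate (h : IsRegMild c m K t₀ t₁ V) (hK : 1 ≤ K) (r : ℝ) : Integrable (erate c m V r) volume := by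
  have heq : erate c m V r = fun ξ => -(2 * c) * (‖ξ‖ ^ 2 * ∑ l, ‖V r ξ l‖ ^ 2) -
      2 * (∑ l, conj (V r ξ l) * nonlin (vmul m (V r)) (V r) ξ l).re := funext (erate_eq r)
  rw [heq]
  have hI2 : Integrable (fun ξ => 2 * (∑ l, conj (V r ξ l) * nonlin (vmul m (V r)) (V r) ξ l).re) volume := by
    have := (h.integrable_sum_conj_mul_nonlin hK r).re.const_mul 2
    simpa only [RCLike.re_to_complex] using this
  exact ((h.integrable_normSq_mul_sum_normSq hK r).const_mul _).sub hI2

/-- **The `ξ`-integral of the energy rate is the dissipation**: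
`∫ q(r, ξ) dξ = -2c ∫ ‖ξ‖² ∑ₗ ‖V(r,ξ)ₗ‖² dξ` (the convective part cancels,
`integral_sum_conj_mul_nonlin_vmul_self`). [folklore] -/
theorem integral_erate (h : IsRegMild c m K t₀ t₁ V) (hK : 1 ≤ K) (r : ℝ) :
    ∫ ξ, erate c m V r ξ = -(2 * c) * ∫ ξ : EuclideanSpace ℝ ι, ‖ξ‖ ^ 2 * ∑ l, ‖V r ξ l‖ ^ 2 := by
  have heq : erate c m V r = fun ξ => -(2 * c) * (‖ξ‖ ^ 2 * ∑ l, ‖V r ξ l‖ ^ 2) -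
      2 * (∑ l, conj (V r ξ l) * nonlin (vmul m (V r)) (V r) ξ l).re := funext (erate_eq r)
  have hcancel : ∫ ξ, (∑ l, conj (V r ξ l) * nonlin (vmul m (V r)) (V r) ξ l).re = 0 := by
    have h1 := integral_re (h.integrable_sum_conj_mul_nonlin hK r)
    simp only [RCLike.re_to_complex] at h1
    rw [h1, integral_sum_conj_mul_nonlin_vmul_self h.hm.measurable h.hm.abs_le_one
      (by simpa using h.hm.eLpNorm_wfun_lt_top 0) (h.measurable_slice' r) (h.memLp r)
      ((eLpNorm_wfun_mono hK (V r) 2).trans_lt (h.eLpNorm_wfun_lt_top r)) (h.divFree r) (h.conjSymm r),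
      Complex.zero_re]
  have hI1 : Integrable (fun ξ : EuclideanSpace ℝ ι => -(2 * c) * (‖ξ‖ ^ 2 * ∑ l, ‖V r ξ l‖ ^ 2)) volume :=
    (h.integrable_normSq_mul_sum_normSq hK r).const_mul _
  have hI2 : Integrable (fun ξ => 2 * (∑ l, conj (V r ξ l) * nonlin (vmul m (V r)) (V r) ξ l).re) volume := by
    have := (h.integrable_sum_conj_mul_nonlin hK r).re.const_mul 2
    simpa only [RCLike.re_to_complex] using this
  rw [heq]
  show ∫ ξ : EuclideanSpace ℝ ι, (-(2 * c) * (‖ξ‖ ^ 2 * ∑ l, ‖V r ξ l‖ ^ 2) -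
      2 * (∑ l, conj (V r ξ l) * nonlin (vmul m (V r)) (V r) ξ l).re) = _
  rw [integral_sub hI1 hI2, MeasureTheory.integral_const_mul, MeasureTheory.integral_const_mul, hcancel, mul_zero,
    sub_zero]


/-- Joint measurability of the energy rate in `(r, ξ)`. [folklore] -/
theorem measurable_erate (h : IsRegMild c m K t₀ t₁ V) : Measurable (uncurry (erate c m V)) := by
  have hN := measurable_nonlin_param h.hm.measurable h.meas h.meas
  have hterm : ∀ l, Measurable fun p : ℝ × EuclideanSpace ℝ ι =>
      2 * ((-((c * ‖p.2‖ ^ 2 : ℝ) : ℂ) * V p.1 p.2 l - nonlin (vmul m (V p.1)) (V p.1) p.2 l) * conj (V p.1 p.2 l)).re := by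
    intro l
    have hV : Measurable fun p : ℝ × EuclideanSpace ℝ ι => V p.1 p.2 l := measurable_pi_iff.1 h.meas l
    have hNl : Measurable fun p : ℝ × EuclideanSpace ℝ ι => nonlin (vmul m (V p.1)) (V p.1) p.2 l :=
      measurable_pi_iff.1 hN l
    have hβ : Measurable fun p : ℝ × EuclideanSpace ℝ ι => -((c * ‖p.2‖ ^ 2 : ℝ) : ℂ) :=
      (Complex.measurable_ofReal.comp (by fun_prop)).neg
    exact measurable_const.mul (Complex.measurable_re.comp (((hβ.mul hV).sub hNl).mul
      (Complex.continuous_conj.measurable.comp hV)))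
  have : uncurry (erate c m V) = fun p : ℝ × EuclideanSpace ℝ ι =>
      ∑ l, 2 * ((-((c * ‖p.2‖ ^ 2 : ℝ) : ℂ) * V p.1 p.2 l - nonlin (vmul m (V p.1)) (V p.1) p.2 l) * conj (V p.1 p.2 l)).re := by
    funext p; rfl
  rw [this]
  exact Finset.measurable_sum _ fun l _ => hterm l

/-- **Pointwise bound of the energy rate**:
`‖q(r,ξ)‖ₑ ≤ 2c · card · ‖wfun 1 V(r) ξ‖ₑ² + 2 · card · ‖V(r,ξ)‖ₑ ‖N(r,ξ)‖ₑ`. [folklore] -/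
theorem enorm_erate_le (h : IsRegMild c m K t₀ t₁ V) (r : ℝ) (ξ : EuclideanSpace ℝ ι) :
    ‖erate c m V r ξ‖ₑ ≤ ENNReal.ofReal (2 * c) * (Fintype.card ι : ℝ≥0∞) * ‖wfun 1 (V r) ξ‖ₑ ^ 2 +
      2 * (Fintype.card ι : ℝ≥0∞) * (‖V r ξ‖ₑ * ‖nonlin (vmul m (V r)) (V r) ξ‖ₑ) := by
  have hc := h.hc.le
  have hreal : ‖erate c m V r ξ‖ ≤ 2 * c * (Fintype.card ι : ℝ) * ‖wfun 1 (V r) ξ‖ ^ 2 +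
      2 * (Fintype.card ι : ℝ) * (‖V r ξ‖ * ‖nonlin (vmul m (V r)) (V r) ξ‖) := by
    rw [erate_eq, Real.norm_eq_abs]
    refine (abs_sub _ _).trans (add_le_add ?_ ?_)
    · rw [abs_mul, abs_neg, abs_of_nonneg (by positivity : (0 : ℝ) ≤ 2 * c), abs_of_nonneg (by positivity)]
      have h1 : ∑ l, ‖V r ξ l‖ ^ 2 ≤ (Fintype.card ι : ℝ) * ‖V r ξ‖ ^ 2 := by
        calc ∑ l, ‖V r ξ l‖ ^ 2 ≤ ∑ _l : ι, ‖V r ξ‖ ^ 2 := Finset.sum_le_sum fun l _ => by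
              gcongr; exact norm_le_pi_norm _ l
          _ = (Fintype.card ι : ℝ) * ‖V r ξ‖ ^ 2 := by rw [Finset.sum_const, Finset.card_univ, nsmul_eq_mul]
      have h2 : ‖ξ‖ ^ 2 * ‖V r ξ‖ ^ 2 ≤ ‖wfun 1 (V r) ξ‖ ^ 2 := by
        rw [norm_wfun, pow_one, mul_pow]; gcongr; linarith [norm_nonneg ξ]
      calc 2 * c * (‖ξ‖ ^ 2 * ∑ l, ‖V r ξ l‖ ^ 2) ≤ 2 * c * (‖ξ‖ ^ 2 * ((Fintype.card ι : ℝ) * ‖V r ξ‖ ^ 2)) := by gcongr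
        _ = 2 * c * (Fintype.card ι : ℝ) * (‖ξ‖ ^ 2 * ‖V r ξ‖ ^ 2) := by ring
        _ ≤ 2 * c * (Fintype.card ι : ℝ) * ‖wfun 1 (V r) ξ‖ ^ 2 := by gcongr
    · rw [abs_mul, abs_of_nonneg (by norm_num : (0 : ℝ) ≤ 2), mul_assoc]
      refine mul_le_mul_of_nonneg_left ?_ (by norm_num)
      calc |(∑ l, conj (V r ξ l) * nonlin (vmul m (V r)) (V r) ξ l).re|
          ≤ ‖∑ l, conj (V r ξ l) * nonlin (vmul m (V r)) (V r) ξ l‖ := Complex.abs_re_le_norm _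
        _ ≤ ∑ l, ‖conj (V r ξ l) * nonlin (vmul m (V r)) (V r) ξ l‖ := norm_sum_le _ _
        _ ≤ ∑ _l : ι, ‖V r ξ‖ * ‖nonlin (vmul m (V r)) (V r) ξ‖ := Finset.sum_le_sum fun l _ => by
            rw [norm_mul, Complex.norm_conj]
            exact mul_le_mul (norm_le_pi_norm _ l) (norm_le_pi_norm _ l) (norm_nonneg _) (norm_nonneg _)
        _ = (Fintype.card ι : ℝ) * (‖V r ξ‖ * ‖nonlin (vmul m (V r)) (V r) ξ‖) := by
            rw [Finset.sum_const, Finset.card_univ, nsmul_eq_mul]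
  have e1 : ENNReal.ofReal (2 * c * (Fintype.card ι : ℝ) * ‖wfun 1 (V r) ξ‖ ^ 2) =
      ENNReal.ofReal (2 * c) * (Fintype.card ι : ℝ≥0∞) * ‖wfun 1 (V r) ξ‖ₑ ^ 2 := by
    rw [ENNReal.ofReal_mul (p := 2 * c * (Fintype.card ι : ℝ)) (by positivity),
      ENNReal.ofReal_mul (p := 2 * c) (by positivity), ENNReal.ofReal_natCast,
      ENNReal.ofReal_pow (norm_nonneg _), ofReal_norm]
  have e2 : ENNReal.ofReal (2 * (Fintype.card ι : ℝ) * (‖V r ξ‖ * ‖nonlin (vmul m (V r)) (V r) ξ‖)) =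
      2 * (Fintype.card ι : ℝ≥0∞) * (‖V r ξ‖ₑ * ‖nonlin (vmul m (V r)) (V r) ξ‖ₑ) := by
    rw [ENNReal.ofReal_mul (p := 2 * (Fintype.card ι : ℝ)) (by positivity),
      ENNReal.ofReal_mul (p := 2) (by norm_num), ENNReal.ofReal_ofNat, ENNReal.ofReal_natCast,
      ENNReal.ofReal_mul (norm_nonneg _), ofReal_norm, ofReal_norm]
  rw [← ofReal_norm, ← e1, ← e2, ← ENNReal.ofReal_add (by positivity) (by positivity)]
  exact ENNReal.ofReal_le_ofReal hreal

/-- **Uniform `L¹(dξ)` bound of the energy rate** (`1 ≤ K`):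
`∫⁻ ‖q(r,ξ)‖ₑ dξ ≤ 2c card B² + 2 card A (4π κ₁ A B) < ∞`. [folklore] -/
theorem lintegral_enorm_erate_le (h : IsRegMild c m K t₀ t₁ V) (hK : 1 ≤ K) (r : ℝ) :
    ∫⁻ ξ, ‖erate c m V r ξ‖ₑ ≤ ENNReal.ofReal (2 * c) * (Fintype.card ι : ℝ≥0∞) * h.B ^ 2 +
      2 * (Fintype.card ι : ℝ≥0∞) * (h.A * (ENNReal.ofReal (4 * π) * (kap m 1 * h.A * h.B))) := by
  have hVm := h.measurable_slice' r
  have hc : Measurable fun ξ : EuclideanSpace ℝ ι => (r, ξ) := measurable_const.prodMk measurable_id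
  have hNm : Measurable fun ξ => nonlin (vmul m (V r)) (V r) ξ := by
    have := (measurable_nonlin_param h.hm.measurable h.meas h.meas).comp hc
    simpa only [Function.comp_def, uncurry_apply_pair] using this
  calc ∫⁻ ξ, ‖erate c m V r ξ‖ₑ
      ≤ ∫⁻ ξ, (ENNReal.ofReal (2 * c) * (Fintype.card ι : ℝ≥0∞) * ‖wfun 1 (V r) ξ‖ₑ ^ 2 +
          2 * (Fintype.card ι : ℝ≥0∞) * (‖V r ξ‖ₑ * ‖nonlin (vmul m (V r)) (V r) ξ‖ₑ)) := lintegral_mono fun ξ => h.enorm_erate_le r ξ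
    _ = ENNReal.ofReal (2 * c) * (Fintype.card ι : ℝ≥0∞) * (∫⁻ ξ, ‖wfun 1 (V r) ξ‖ₑ ^ 2) +
          2 * (Fintype.card ι : ℝ≥0∞) * ∫⁻ ξ, ‖V r ξ‖ₑ * ‖nonlin (vmul m (V r)) (V r) ξ‖ₑ := by
        have hm2 : Measurable fun ξ => ‖V r ξ‖ₑ * ‖nonlin (vmul m (V r)) (V r) ξ‖ₑ := hVm.enorm.mul hNm.enorm
        rw [lintegral_add_left (((measurable_wfun 1 hVm).enorm.pow_const 2).const_mul _),
          lintegral_const_mul _ ((measurable_wfun 1 hVm).enorm.pow_const 2),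
          lintegral_const_mul _ hm2]
    _ ≤ ENNReal.ofReal (2 * c) * (Fintype.card ι : ℝ≥0∞) * h.B ^ 2 +
          2 * (Fintype.card ι : ℝ≥0∞) * (h.A * (ENNReal.ofReal (4 * π) * (kap m 1 * h.A * h.B))) := by
        refine add_le_add (mul_le_mul_right ?_ _) (mul_le_mul_right ?_ _)
        · rw [lintegral_enorm_sq_eq_eLpNorm_sq]
          exact pow_le_pow_left₀ zero_le ((eLpNorm_wfun_mono hK (V r) 2).trans (h.eLpNorm_wfun_le_B r)) 2
        · have hH := ENNReal.lintegral_mul_le_Lp_mul_Lq volume Real.HolderConjugate.two_two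
            hVm.enorm.aemeasurable hNm.enorm.aemeasurable
          simp only [Pi.mul_apply] at hH
          refine hH.trans ?_
          have e1 : (∫⁻ ξ, ‖V r ξ‖ₑ ^ (2 : ℝ)) ^ (1 / (2 : ℝ)) = eLpNorm (V r) 2 volume := by
            rw [eLpNorm_eq_lintegral_rpow_enorm_toReal two_ne_zero ENNReal.ofNat_ne_top, ENNReal.toReal_ofNat]
          have e2 : (∫⁻ ξ, ‖nonlin (vmul m (V r)) (V r) ξ‖ₑ ^ (2 : ℝ)) ^ (1 / (2 : ℝ)) =
              eLpNorm (fun ξ => nonlin (vmul m (V r)) (V r) ξ) 2 volume := by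
            rw [eLpNorm_eq_lintegral_rpow_enorm_toReal two_ne_zero ENNReal.ofNat_ne_top, ENNReal.toReal_ofNat]
          rw [e1, e2]
          exact mul_le_mul' (h.eLpNorm_le_A r) (h.eLpNorm_nonlin_le hK r)


/-- **Product integrability of the energy rate** on `E × (s, t]` (`1 ≤ K`): joint measurability and
the uniform `L¹(dξ)` bound (Tonelli). [folklore] -/
theorem integrable_erate_prod (h : IsRegMild c m K t₀ t₁ V) (hK : 1 ≤ K) (s t : ℝ) :
    Integrable (uncurry fun (ξ : EuclideanSpace ℝ ι) (r : ℝ) => erate c m V r ξ)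
      ((volume : Measure (EuclideanSpace ℝ ι)).prod (volume.restrict (Ioc s t))) := by
  have h0 : (uncurry fun (ξ : EuclideanSpace ℝ ι) (r : ℝ) => erate c m V r ξ) = uncurry (erate c m V) ∘ Prod.swap := by
    funext p; rfl
  have hmeas : Measurable (uncurry fun (ξ : EuclideanSpace ℝ ι) (r : ℝ) => erate c m V r ξ) := by
    rw [h0]; exact h.measurable_erate.comp measurable_swap
  refine ⟨hmeas.aestronglyMeasurable, ?_⟩
  set M : ℝ≥0∞ := ENNReal.ofReal (2 * c) * (Fintype.card ι : ℝ≥0∞) * h.B ^ 2 +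
      2 * (Fintype.card ι : ℝ≥0∞) * (h.A * (ENNReal.ofReal (4 * π) * (kap m 1 * h.A * h.B))) with hM
  have hMtop : M ≠ ∞ := by
    refine ENNReal.add_ne_top.2 ⟨ENNReal.mul_ne_top (ENNReal.mul_ne_top ENNReal.ofReal_ne_top (ENNReal.natCast_ne_top _))
      (ENNReal.pow_ne_top h.B_ne_top), ENNReal.mul_ne_top (ENNReal.mul_ne_top ENNReal.ofNat_ne_top (ENNReal.natCast_ne_top _))
      (ENNReal.mul_ne_top h.A_ne_top (ENNReal.mul_ne_top ENNReal.ofReal_ne_top (ENNReal.mul_ne_top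
      (ENNReal.mul_ne_top (h.hm.kap_ne_top 1) h.A_ne_top) h.B_ne_top)))⟩
  calc ∫⁻ p, ‖uncurry (fun (ξ : EuclideanSpace ℝ ι) (r : ℝ) => erate c m V r ξ) p‖ₑ
        ∂((volume : Measure (EuclideanSpace ℝ ι)).prod (volume.restrict (Ioc s t)))
      = ∫⁻ r in Ioc s t, ∫⁻ ξ, ‖erate c m V r ξ‖ₑ := by
        rw [lintegral_prod_symm _ hmeas.enorm.aemeasurable]; rfl
    _ ≤ ∫⁻ _r in Ioc s t, M := lintegral_mono fun r => h.lintegral_enorm_erate_le hK r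
    _ = M * volume (Ioc s t) := setLIntegral_const _ _
    _ < ∞ := ENNReal.mul_lt_top hMtop.lt_top measure_Ioc_lt_top

/-- **The energy identity of a regularised mild solution** (Fourier side of Leray's "relation de
dissipation de l'énergie" for the regularised system; Leray 1934, (3.4) with §26; Ożański–Pooley
2018, (6.80)): for `1 ≤ K` and `t₀ ≤ s ≤ t ≤ t₁`,
`∫ ∑ₗ ‖V(t,ξ)ₗ‖² dξ + 2c ∫ₛᵗ ∫ ‖ξ‖² ∑ₗ ‖V(r,ξ)ₗ‖² dξ dr = ∫ ∑ₗ ‖V(s,ξ)ₗ‖² dξ`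
(pointwise balance, Fubini, and the cancellation of the convective part). [folklore] -/
theorem energy_eq (h : IsRegMild c m K t₀ t₁ V) (hK : 1 ≤ K) {s t : ℝ} (hs : t₀ ≤ s) (hst : s ≤ t) (ht : t ≤ t₁) :
    (∫ ξ, ∑ l, ‖V t ξ l‖ ^ 2) + 2 * c * ∫ r in s..t, ∫ ξ : EuclideanSpace ℝ ι, ‖ξ‖ ^ 2 * ∑ l, ‖V r ξ l‖ ^ 2 =
      ∫ ξ, ∑ l, ‖V s ξ l‖ ^ 2 := by
  -- integrate the pointwise balance over `ξ`
  have h1 : (∫ ξ, ∑ l, ‖V t ξ l‖ ^ 2) - ∫ ξ, ∑ l, ‖V s ξ l‖ ^ 2 = ∫ ξ, ∫ r in s..t, erate c m V r ξ := by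
    rw [← integral_sub (h.integrable_sum_normSq t) (h.integrable_sum_normSq s)]
    exact integral_congr_ae (Eventually.of_forall fun ξ => h.sum_normSq_sub_eq_integral_erate ξ hs hst ht)
  -- Fubini
  have h2 : ∫ ξ, ∫ r in s..t, erate c m V r ξ = ∫ r in s..t, ∫ ξ, erate c m V r ξ := by
    simp_rw [intervalIntegral.integral_of_le hst]
    exact integral_integral_swap (h.integrable_erate_prod hK s t)
  -- the inner integral is the dissipation
  have h3 : ∫ r in s..t, ∫ ξ, erate c m V r ξ = -(2 * c) * ∫ r in s..t, ∫ ξ : EuclideanSpace ℝ ι, ‖ξ‖ ^ 2 * ∑ l, ‖V r ξ l‖ ^ 2 := by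
    rw [← intervalIntegral.integral_const_mul]
    exact intervalIntegral.integral_congr fun r _ => h.integral_erate hK r
  have := h1.trans (h2.trans h3)
  linarith

/-- **The energy is non-increasing**: `∫ ∑ₗ ‖V(t,ξ)ₗ‖² dξ ≤ ∫ ∑ₗ ‖V(s,ξ)ₗ‖² dξ` for `s ≤ t` in
`[t₀, t₁]` (`1 ≤ K`). [folklore] -/
theorem energy_le (h : IsRegMild c m K t₀ t₁ V) (hK : 1 ≤ K) {s t : ℝ} (hs : t₀ ≤ s) (hst : s ≤ t) (ht : t ≤ t₁) :
    ∫ ξ, ∑ l, ‖V t ξ l‖ ^ 2 ≤ ∫ ξ, ∑ l, ‖V s ξ l‖ ^ 2 := by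
  have h1 := h.energy_eq hK hs hst ht
  have h2 : 0 ≤ 2 * c * ∫ r in s..t, ∫ ξ : EuclideanSpace ℝ ι, ‖ξ‖ ^ 2 * ∑ l, ‖V r ξ l‖ ^ 2 := by
    refine mul_nonneg (by linarith [h.hc]) (intervalIntegral.integral_nonneg hst fun r _ => ?_)
    exact integral_nonneg fun ξ => by positivity
  linarith


end IsRegMild

/-! ### The Picard limit is a regularised mild solution -/

section Picard

variable {c T : ℝ} {m : (EuclideanSpace ℝ ι) → ℝ} {K : ℕ} {A AK : ℝ≥0∞} {a : (EuclideanSpace ℝ ι) → ι → ℂ}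

/-- **The Picard limit is a regularised mild solution on `[0, T]`** for `2K > card ι` and a
transversal, conjugation-symmetric datum: the fixed-point identity is the Duhamel formula from
time `0`, the two-time form follows from the semigroup law of the heat factor and additivity of the
time integral; the domination is `‖v(t,ξ)‖ ≤ ‖a ξ‖ + C (1+‖ξ‖)^{-K}` (Leray 1934, §19/§26;
Lemarié-Rieusset 2016, §8.5). [folklore] -/
theorem RPicardHyp.isRegMild_limit (h : RPicardHyp c m K T A AK a) (hK : Fintype.card ι < 2 * K)
    (hdiv : ∀ ξ, ∑ l, (ξ l : ℂ) * a ξ l = 0) (hconj : ∀ ξ l, a (-ξ) l = conj (a ξ l)) :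
    IsRegMild c m K 0 T (rpicardLimit c m T a) := by
  set v := rpicardLimit c m T a with hv
  have hm := h.hm.measurable
  have hm1 := h.hm.abs_le_one
  refine
    { hc := h.hc
      hm := h.hm
      le := h.hT.le
      meas := h.measurable_limit
      cont := h.continuous_limit_time
      dom := ?_
      boundK := ⟨2 * AK, ENNReal.mul_ne_top ENNReal.ofNat_ne_top h.AK_ne_top, h.eLpNorm_wfun_limit_le⟩
      duhamel := ?_
      divFree := h.sum_mul_limit hdiv
      conjSymm := h.limit_conj_symm hconj }
  · -- domination
    obtain ⟨C, hCtop, hdom⟩ := h.exists_enorm_limit_le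
    refine ⟨fun ξ => ‖a ξ‖ₑ + C * (ENNReal.ofReal ((1 + ‖ξ‖) ^ K))⁻¹, ?_, ?_, hdom⟩
    · exact h.meas.enorm.add ((ENNReal.measurable_ofReal.comp (by fun_prop)).inv.const_mul _)
    · have ha2 : ∫⁻ ξ, ‖a ξ‖ₑ ^ 2 ∂(volume : Measure (EuclideanSpace ℝ ι)) ≠ ∞ := by
        rw [lintegral_enorm_sq_eq_eLpNorm_sq]
        exact ENNReal.pow_ne_top (ne_top_of_le_ne_top h.A_ne_top h.boundA)
      have hw2 : ∫⁻ ξ : EuclideanSpace ℝ ι, ((ENNReal.ofReal ((1 + ‖ξ‖) ^ K))⁻¹) ^ 2 ≠ ∞ := by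
        have hint : Integrable (fun ξ : EuclideanSpace ℝ ι => ((1 + ‖ξ‖) ^ (2 * K))⁻¹) volume :=
          integrable_inv_one_add_norm_pow (by simpa using hK)
        refine ne_top_of_le_ne_top hint.hasFiniteIntegral.ne (le_of_eq (lintegral_congr fun ξ => ?_))
        have hpos : 0 < (1 + ‖ξ‖) ^ K := by positivity
        rw [← ENNReal.ofReal_inv_of_pos hpos, ← ENNReal.ofReal_pow (by positivity), Real.enorm_eq_ofReal (by positivity)]
        congr 1
        rw [inv_pow, ← pow_mul, mul_comm K 2]
      calc ∫⁻ ξ, (‖a ξ‖ₑ + C * (ENNReal.ofReal ((1 + ‖ξ‖) ^ K))⁻¹) ^ 2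
          ≤ ∫⁻ ξ, 4 * (‖a ξ‖ₑ ^ 2 + (C * (ENNReal.ofReal ((1 + ‖ξ‖) ^ K))⁻¹) ^ 2) :=
            lintegral_mono fun ξ => RPicardHyp.sq_add_le_four_mul _ _
        _ = 4 * ((∫⁻ ξ, ‖a ξ‖ₑ ^ 2) + C ^ 2 * ∫⁻ ξ : EuclideanSpace ℝ ι, ((ENNReal.ofReal ((1 + ‖ξ‖) ^ K))⁻¹) ^ 2) := by
            rw [lintegral_const_mul' _ _ ENNReal.ofNat_ne_top, lintegral_add_left (h.meas.enorm.pow_const 2)]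
            simp_rw [mul_pow]
            rw [lintegral_const_mul' _ _ (ENNReal.pow_ne_top hCtop)]
        _ < ∞ := ENNReal.mul_lt_top ENNReal.ofNat_lt_top (ENNReal.add_lt_top.2 ⟨ha2.lt_top,
            ENNReal.mul_lt_top (ENNReal.pow_lt_top hCtop.lt_top) hw2.lt_top⟩)
  · -- the two-time Duhamel formula
    intro s t hs hst ht ξ
    have htI : t ∈ Icc 0 T := ⟨hs.trans hst, ht⟩
    have hsI : s ∈ Icc 0 T := ⟨hs, hst.trans ht⟩
    have hfix : ∀ {τ}, τ ∈ Icc 0 T → v τ ξ = heat c ξ τ • a ξ -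
        ∫ r in (0 : ℝ)..τ, heat c ξ (τ - r) • nonlin (vmul m (v r)) (v r) ξ := by
      intro τ hτ
      have := h.fixed τ ξ
      rw [rduhamel, duhamelR, clamp_of_mem hτ] at this
      exact this
    have hint : ∀ a' b' : ℝ, IntervalIntegrable (fun r => heat c ξ (t - r) • nonlin (vmul m (v r)) (v r) ξ) volume a' b' :=
      fun a' b' => h.sliceBound_limit.intervalIntegrable_integrand' hm hm1 h.hc.le t ξ a' b'
    rw [hfix htI, hfix hsI, smul_sub, smul_smul, ← heat_add, show t - s + s = t by ring,
      ← intervalIntegral.integral_smul, ← intervalIntegral.integral_add_adjacent_intervals (hint 0 s) (hint s t)]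
    have hI : ∫ r in (0 : ℝ)..s, heat c ξ (t - s) • heat c ξ (s - r) • nonlin (vmul m (v r)) (v r) ξ =
        ∫ r in (0 : ℝ)..s, heat c ξ (t - r) • nonlin (vmul m (v r)) (v r) ξ := by
      refine intervalIntegral.integral_congr fun r _ => ?_
      simp only [smul_smul, ← heat_sub_sub]
    rw [hI]
    abel

end Picard

end Literature.Analysis.FluidPDE.FourierNS

end
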